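import Literature.Computability.Complexity.Williams2014Expand
import Literature.Computability.Complexity.Williams2014SatInstanceFP
import HarnessLib

/-!
# The `ACC → SYM⁺` conversion on codes

R. Williams, *Nonuniform ACC circuit lower bounds*, J. ACM 61 (2014), Lemma 4.1 and Appendix A.
The explicit `SYM⁺` circuit `BT.accSymPlus d m hm C` (`Williams2014Collapse.lean`) and its code
(`symPlusCodeList`, through `Williams2014Expand.lean`) are functions of the CIRCUIT; Williams'
algorithm reads the circuit's CODE. This file carries the whole construction out on codes — lists
of naturals in the vocabulary of `Williams2014SatInstanceCode.lean` / `Williams2014SatInstanceFP.lean` (`SatCode.WireC = ℕ × ℕ`,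
`SatCode.GateC = ℕ × List WireC`, `gateC m`, `wireC`) — by elementary list functions (the functions
the polynomial-time program of `Williams2014ConvFP*.lean` computes literally), and proves that on
the code of a circuit over `accBasis m` they produce the code of `accSymPlus d m hm C`:

* parameters `szC` (`= sC`) and the source table `srcTableC` (the source literals `srcLit`,
  `getD_srcTableC`); the `ac`-depth table is the sibling file's `SatCode.depthsC`
  (`depthsC_map_gateC`);
* token builders `oneSubToks`, `sumLToks`, `prodLToks`, `powToks`, `litToksC` (`= rpn ∘ litF`),
  `esymToksC`, `auxToksC`, `andToksC`, `orToksC`, `modToksC`, `ffToksC` (`= rpn ∘ FF'`,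
  `ffToksC_eq`), the stage substitution `substTokC` (`= rpn ∘ tau`), `topToksC`, `toksC`
  (`toksC k = rpn (Rk k)`, `toksC_eq`);
* the arithmetic of the symmetric gate without a `Setup`: `stagePrimeC`, `chainC`, `symOfC`
  (`chain_eq_chainC`, `symOf_eq_symOfC`);
* **`convCode d m`** and **`convCode_eq`**: `convCode d m (n, wireC C.output, C.gates.map (gateC m))
  = symPlusCodeList (accSymPlus d m hm C)` for `C` over `accBasis m`.

No new named fact; everything is proved.

## References

* R. Williams, *Nonuniform ACC circuit lower bounds*, J. ACM 61 (2014), Lemma 4.1, Appendix A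
  [Williams2014].
-/

namespace Literature.Computability.Complexity

open Finset SatCode GateList

namespace BT

variable {n : ℕ}

/-! ### Small list utilities -/

/-- `sublistsLen` commutes with `map`. [folklore] -/
theorem sublistsLen_map {α β : Type*} (f : α → β) : ∀ (q : ℕ) (l : List α),
    (l.map f).sublistsLen q = (l.sublistsLen q).map (List.map f)
  | 0, l => by simp [List.sublistsLen_zero]
  | q + 1, [] => by simp [List.sublistsLen_succ_nil]
  | q + 1, a :: l => by
    rw [List.map_cons, List.sublistsLen_succ_cons, List.sublistsLen_succ_cons, sublistsLen_map f (q + 1) l,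
      sublistsLen_map f q l, List.map_append, List.map_map, List.map_map]
    rfl

/-! ### Parameters and tables -/

/-- The size parameter from the gate codes: the larger of the number of gates and the fan-in
(`= sC`, `szC_eq`). [folklore] -/
def szC (gs : List GateC) : ℕ := max gs.length (SatCode.maxL (gs.map fun g => g.2.length))

/-- One more entry of the source table: a negation (code `0`) of an input is that input negated, a
negation of an earlier gate flips that gate's source, anything else is itself. [folklore] -/
def srcEntry (acc : List (Bool × WireC)) (g : GateC) : Bool × WireC :=
  if g.1 = 0 then
    if (g.2.headD (2, 0)).1 = 0 then (true, (0, (g.2.headD (2, 0)).2))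
    else if (g.2.headD (2, 0)).1 = 1 ∧ (g.2.headD (2, 0)).2 < acc.length then
      (!(acc.getD (g.2.headD (2, 0)).2 (false, (0, 0))).1, (acc.getD (g.2.headD (2, 0)).2 (false, (0, 0))).2)
    else (false, (1, acc.length))
  else (false, (1, acc.length))

/-- The source-literal table of the gates (`srcLit`, resolved chains of negations). [folklore] -/
def srcTableC (gs : List GateC) : List (Bool × WireC) := gs.foldl (fun acc g => acc ++ [srcEntry acc g]) []

/-! ### Token builders -/

/-- Tokens of `1 - F` from the tokens of `F`. [folklore] -/
def oneSubToks (f : List Tok) : List Tok := Tok.cst 1 :: (Tok.cst (-1) :: (f ++ [Tok.mul])) ++ [Tok.add]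

/-- Tokens of a list sum from the tokens of the summands. [folklore] -/
def sumLToks (L : List (List Tok)) : List Tok := L.flatten ++ (Tok.cst 0 :: List.replicate L.length Tok.add)

/-- Tokens of a list product from the tokens of the factors. [folklore] -/
def prodLToks (L : List (List Tok)) : List Tok := L.flatten ++ (Tok.cst 1 :: List.replicate L.length Tok.mul)

/-- Tokens of a power. [folklore] -/
def powToks (e : ℕ) (f : List Tok) : List Tok :=
  (List.replicate e f).flatten ++ (Tok.cst 1 :: List.replicate e Tok.mul)

/-- Tokens of the base variable of a wire code in copy `c`. [folklore] -/
def baseToksC (c : ℕ) (w : WireC) : List Tok := if w.1 = 0 then [Tok.inp w.2] else [Tok.gv c w.2 0]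

/-- Tokens of the literal of a wire code in copy `c`, given the source table. [folklore] -/
def litToksC (src : List (Bool × WireC)) (c : ℕ) (w : WireC) : List Tok :=
  if w.1 = 0 then [Tok.inp w.2]
  else if (src.getD w.2 (false, (1, w.2))).1 then oneSubToks (baseToksC c (src.getD w.2 (false, (1, w.2))).2)
  else baseToksC c (src.getD w.2 (false, (1, w.2))).2

/-- Tokens of `e_q` in the literals of the wires `ws`. [cite: BeigelTarui1994, Lemma 2.1] -/
def esymToksC (src : List (Bool × WireC)) (c : ℕ) (ws : List WireC) (q : ℕ) : List Tok :=
  sumLToks (((List.range ws.length).sublistsLen q).map fun A =>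
    prodLToks (A.map fun a => litToksC src c (ws.getD a (0, 0))))

/-- Tokens of the auxiliary `MOD_{p^e}` polynomial. [cite: BeigelTarui1994, Lemma 2.1] -/
def auxToksC (m : ℕ) (src : List (Bool × WireC)) (c : ℕ) (ws : List WireC) (p : ℕ) : List Tok :=
  oneSubToks (prodLToks ((List.range (m.factorization p)).map fun t =>
    oneSubToks (powToks (p - 1) (esymToksC src c ws (p ^ t)))))

/-- Tokens of the randomized AND polynomial. [cite: BeigelTarui1994, Lemma 2.5] -/
def andToksC (s T₀ : ℕ) (src : List (Bool × WireC)) (c j : ℕ) (ws : List WireC) : List Tok :=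
  prodLToks ((List.range T₀).map fun t =>
    oneSubToks (sumLToks (((List.range ws.length).filter fun a => vvSeed s c j t a).map fun a =>
      oneSubToks (litToksC src c (ws.getD a (0, 0))))))

/-- Tokens of the randomized OR polynomial. [cite: BeigelTarui1994, Lemma 2.5] -/
def orToksC (s T₀ : ℕ) (src : List (Bool × WireC)) (c j : ℕ) (ws : List WireC) : List Tok :=
  oneSubToks (prodLToks ((List.range T₀).map fun t =>
    oneSubToks (sumLToks (((List.range ws.length).filter fun a => vvSeed s c j t a).map fun a =>
      litToksC src c (ws.getD a (0, 0))))))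

/-- Tokens of the MOD polynomial. [cite: BeigelTarui1994, Lemma 2.5] -/
def modToksC (m c j : ℕ) : List Tok :=
  oneSubToks (prodLToks ((primesL m).map fun p => oneSubToks [Tok.gv c j p]))

/-- Tokens of the defining polynomial `FF'` of the variable `(c, j, q)`. [cite: BeigelTarui1994, Lemma 2.5] -/
def ffToksC (m s T₀ : ℕ) (gs : List GateC) (src : List (Bool × WireC)) (c j q : ℕ) : List Tok :=
  if j < gs.length then
    if q = 0 then
      if (gs.getD j (0, [])).1 = 1 then andToksC s T₀ src c j (gs.getD j (0, [])).2
      else if (gs.getD j (0, [])).1 = 2 then orToksC s T₀ src c j (gs.getD j (0, [])).2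
      else modToksC m c j
    else auxToksC m src c (gs.getD j (0, [])).2 q
  else [Tok.cst 0]

/-- Admissibility of the variable `(c, j, q)` on codes. [folklore] -/
def admC (m : ℕ) (gs : List GateC) (j q : ℕ) : Bool :=
  decide (j < gs.length) && !decide ((gs.getD j (0, [])).1 = 0) && (decide (q = 0) || decide (q ∈ m.primeFactors))

/-- The level of the variable `(c, j, q)` on codes. [folklore] -/
def levC (m : ℕ) (ds : List ℕ) (j q : ℕ) : ℕ := (m + 1) * ds.getD j 0 - q

/-- The stage prime of level `L` (a function of `m` alone). [cite: BeigelTarui1994, Lemma 2.8] -/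
def stagePrimeC (m L : ℕ) : ℕ := if L % (m + 1) = 0 then 2 else m + 1 - L % (m + 1)

/-- The substitution of stage `k` on tokens: a batch variable is replaced by the tokens of its
amplified Fermat power, every other token is kept. [cite: BeigelTarui1994, Lemma 2.8] -/
def substTokC (m s T₀ lam a e₀ Lmax k : ℕ) (gs : List GateC) (ds : List ℕ) (src : List (Bool × WireC)) :
    Tok → List Tok
  | Tok.gv c j q =>
    if admC m gs j q = true ∧ levC m ds j q = Lmax - k then
      todaToks^[Setup.kap lam a e₀ k]
        (powToks (max 2 (stagePrimeC m (Lmax - k)) - 1) (ffToksC m s T₀ gs src c j q))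
    else [Tok.gv c j q]
  | t => [t]

/-- `substTokC` on a variable token. [folklore] -/
theorem substTokC_gv (m s T₀ lam a e₀ Lmax k : ℕ) (gs : List GateC) (ds : List ℕ) (src : List (Bool × WireC))
    (c j q : ℕ) : substTokC m s T₀ lam a e₀ Lmax k gs ds src (Tok.gv c j q) =
      if admC m gs j q = true ∧ levC m ds j q = Lmax - k then
        todaToks^[Setup.kap lam a e₀ k] (powToks (max 2 (stagePrimeC m (Lmax - k)) - 1) (ffToksC m s T₀ gs src c j q))
      else [Tok.gv c j q] := rfl

/-- `substTokC` on an input token. [folklore] -/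
theorem substTokC_inp (m s T₀ lam a e₀ Lmax k : ℕ) (gs : List GateC) (ds : List ℕ) (src : List (Bool × WireC))
    (i : ℕ) : substTokC m s T₀ lam a e₀ Lmax k gs ds src (Tok.inp i) = [Tok.inp i] := rfl

/-- The tokens of the top formula: the output literals of the `T` copies, summed. [cite: BeigelTarui1994, Lemma 2.5] -/
def topToksC (T : ℕ) (src : List (Bool × WireC)) (out : WireC) : List Tok :=
  sumLToks ((List.range T).map fun c => litToksC src c out)

/-- The tokens after `k` stages. [cite: BeigelTarui1994, Lemma 2.8] -/
def toksC (m s T₀ T lam a e₀ Lmax : ℕ) (gs : List GateC) (ds : List ℕ) (src : List (Bool × WireC))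
    (out : WireC) : ℕ → List Tok
  | 0 => topToksC T src out
  | k + 1 => (toksC m s T₀ T lam a e₀ Lmax gs ds src out k).flatMap (substTokC m s T₀ lam a e₀ Lmax k gs ds src)

/-! ### The symmetric gate without a setup -/

/-- The decoder chain as a function of `m` (`= Setup.chain`, `chain_eq_chainC`). [cite: BeigelTarui1994, §2.4] -/
def chainC (m lam a e₀ Lmax : ℕ) : ℕ → ℤ → ℤ
  | 0 => id
  | k + 1 => chainC m lam a e₀ Lmax k ∘ fun z =>
      (z + Setup.Wb lam a e₀ k) % (((max 2 (stagePrimeC m (Lmax - k))) ^ 2 ^ Setup.kap lam a e₀ k : ℕ) : ℤ) -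
        Setup.Wb lam a e₀ k

/-- The symmetric gate as a function of `m` (`= Setup.symOf`, `symOf_eq_symOfC`). [cite: BeigelTarui1994, Thm. 1.1] -/
def symOfC (m T lam a e₀ Lmax N : ℕ) : Bool :=
  decide ((T : ℤ) < 2 * chainC m lam a e₀ Lmax Lmax
    ((((N : ℕ) : ℤ) + Setup.Wb lam a e₀ Lmax) % (Setup.Kf lam a e₀ Lmax : ℤ) - Setup.Wb lam a e₀ Lmax))

/-! ### The conversion on codes -/

/-- **The `ACC → SYM⁺` conversion on codes**: from `(n, output wire, gate codes)` to the code list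
of the explicit `SYM⁺` circuit — parameters, tables, the tokens of the collapsed formula after
`(m+1)·d` stages, one stack expansion, the AND-terms with multiplicities `a mod K_f`, and the table
of the symmetric gate. [cite: Williams2014, Lemma 4.1 and Appendix A] -/
def convCode (d m : ℕ) (inp : ℕ × WireC × List GateC) : List ℕ :=
  let gs := inp.2.2
  let s := szC gs
  let lam := Nat.log 2 s + 2
  let Lmax := (m + 1) * d
  let P := expandToks (toksC m s (vvT₀ s) (vvT s) lam (4 * m + 10) 7 Lmax gs (depthsC gs) (srcTableC gs) inp.2.1 Lmax)
  let M := Setup.Kf lam (4 * m + 10) 7 Lmax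
  inp.1 :: sizeCode P M :: termsCode P M ++
    (List.range (sizeCode P M + 1)).map fun N => if symOfC m (vvT s) lam (4 * m + 10) 7 Lmax N then 1 else 0

/-! ### The conversion on the code of a circuit: bridges -/

section bridges

variable (m : ℕ) (C : Circuit (Fin n))

/-- `accCode m f = 0` iff `f` is the negation. [folklore] -/
theorem accCode_eq_zero_iff (f : GateFn) : accCode m f = 0 ↔ f = GateFn.not := by
  constructor
  · intro h
    by_contra hne
    unfold accCode at h
    rw [if_neg hne] at h
    split_ifs at h
  · intro h
    rw [h]
    exact accCode_not m

/-- The gate codes of a circuit. [folklore] -/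
abbrev gcodes : List GateC := C.gates.map (gateC m)

/-- There are as many gate codes as gates. [folklore] -/
@[simp] theorem length_gcodes : (gcodes m C).length = C.gates.length := List.length_map _

/-- Reading a gate code. [folklore] -/
theorem getD_gcodes {j : ℕ} (hj : j < C.gates.length) (d : GateC) : (gcodes m C).getD j d = gateC m (C.gates[j]) := by
  rw [List.getD_eq_getElem _ _ (by simpa using hj), List.getElem_map]

/-- The wires of a gate code. [folklore] -/
theorem length_gateC_snd (g : Gate (Fin n)) : (gateC m g).2.length = g.arity := by simp [gateC]

/-- Reading a wire of a gate code. [folklore] -/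
theorem getD_gateC_snd (g : Gate (Fin n)) (a : Fin g.arity) (d : WireC) :
    (gateC m g).2.getD a d = wireC (g.args a) := by
  simp only [gateC]
  rw [List.getD_eq_getElem _ _ (by simp), List.getElem_map, List.getElem_ofFn]

/-- **The size parameter on codes is `sC`.** [folklore] -/
theorem szC_eq : szC (gcodes m C) = sC C := by
  simp only [szC, sC, length_gcodes, List.map_map]
  congr 1
  rw [Circuit.maxFanIn, foldr_max_eq_maxL]
  congr 1
  exact List.map_congr_left fun g _ => length_gateC_snd m g

/-- The reference source table of a circuit: source literals with their wires coded. [folklore] -/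
def srcRef (j : ℕ) : Bool × WireC := ((srcLit C.gates j).1, wireC (srcLit C.gates j).2)

/-- **The source table on codes resolves the chains of negations** (`srcLit`). [folklore] -/
theorem srcTableC_eq : srcTableC (gcodes m C) = (List.range C.gates.length).map (srcRef C) := by
  suffices h : ∀ k, k ≤ C.gates.length →
      ((gcodes m C).take k).foldl (fun acc g => acc ++ [srcEntry acc g]) [] = (List.range k).map (srcRef C) by
    have := h C.gates.length le_rfl
    rwa [List.take_of_length_le (by simp)] at this
  intro k
  induction k with
  | zero => intro; rfl
  | succ k ih =>
    intro hk
    have hk' : k < C.gates.length := hk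
    have hkc : k < (gcodes m C).length := by simpa using hk'
    rw [List.take_add_one, List.getElem?_eq_getElem hkc, Option.toList_some, List.foldl_append,
      ih (Nat.le_of_succ_le hk), List.foldl_cons, List.foldl_nil, List.range_succ, List.map_append,
      List.map_singleton, List.getElem_map]
    congr 2
    -- the new entry
    have hlen : ((List.range k).map (srcRef C)).length = k := by simp
    set g := C.gates[k] with hg
    by_cases hn : g.fn = GateFn.not
    · obtain ⟨w, hw⟩ := GateList.exists_eq_notGate_of_fn_eq hn
      have hcode : (gateC m g).1 = 0 := by rw [hw]; simp [gateC]
      have hws : (gateC m g).2 = [wireC w] := by rw [hw]; simp [gateC, GateList.notGate]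
      cases w with
      | inl i =>
        rw [srcEntry, if_pos hcode, hws]
        simp only [List.headD_cons, wireC, if_true]
        rw [srcRef, srcLit_notGate_inl hk' (hg ▸ hw)]
        rfl
      | inr j' =>
        have hj' : j' < k := lt_of_notGate C hk' (hg ▸ hw)
        rw [srcEntry, if_pos hcode, hws]
        simp only [List.headD_cons, wireC, one_ne_zero, if_false, hlen, hj', and_self, if_true]
        rw [List.getD_eq_getElem _ _ (by simp [hj']), List.getElem_map, List.getElem_range, srcRef, srcRef,
          srcLit_notGate_inr hk' (hg ▸ hw) hj']
    · have hcode : (gateC m g).1 ≠ 0 := fun h => hn ((accCode_eq_zero_iff m g.fn).1 h)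
      rw [srcEntry, if_neg hcode, hlen, srcRef, srcLit_of_not_not hk' hn]
      rfl

/-- Reading the source table (in range). [folklore] -/
theorem getD_srcTableC {j : ℕ} (hj : j < C.gates.length) (d : Bool × WireC) :
    (srcTableC (gcodes m C)).getD j d = srcRef C j := by
  rw [srcTableC_eq, List.getD_eq_getElem _ _ (by simpa using hj), List.getElem_map, List.getElem_range]

/-- Reading the source table (out of range: the default). [folklore] -/
theorem getD_srcTableC_of_le {j : ℕ} (hj : C.gates.length ≤ j) (d : Bool × WireC) :
    (srcTableC (gcodes m C)).getD j d = d := by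
  rw [srcTableC_eq, List.getD_eq_default _ _ (by simpa using hj)]

end bridges

/-! ### Token bridges -/

section tokens

variable {m : ℕ} (hm : 2 ≤ m) (C : Circuit (Fin n)) (hC : C.IsOver (accBasis m))

/-- The fields of `setupOf`. [folklore] -/
@[simp] theorem setupOf_m : (setupOf m hm C hC).m = m := rfl
/-- The fields of `setupOf`. [folklore] -/
@[simp] theorem setupOf_C : (setupOf m hm C hC).C = C := rfl
/-- The fields of `setupOf`. [folklore] -/
@[simp] theorem setupOf_T₀ : (setupOf m hm C hC).T₀ = vvT₀ (sC C) := rfl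
/-- The fields of `setupOf`. [folklore] -/
@[simp] theorem setupOf_βs : (setupOf m hm C hC).βs = vvSeed (sC C) := rfl

/-- `sumLToks` are the tokens of a list sum. [folklore] -/
theorem rpn_sumL_eq (l : List (AForm (V n))) : rpn (AForm.sumL l) = sumLToks (l.map rpn) := by
  rw [rpn_sumL, sumLToks, List.length_map, List.flatMap_def]

/-- `prodLToks` are the tokens of a list product. [folklore] -/
theorem rpn_prodL_eq (l : List (AForm (V n))) : rpn (AForm.prodL l) = prodLToks (l.map rpn) := by
  rw [rpn_prodL, prodLToks, List.length_map, List.flatMap_def]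

/-- `powToks` are the tokens of a power. [folklore] -/
theorem rpn_pow_eq (F : AForm (V n)) (e : ℕ) : rpn (F.pow e) = powToks e (rpn F) := rpn_pow F e

/-- `oneSubToks` are the tokens of `1 - F`. [folklore] -/
theorem rpn_oneSub_eq (F : AForm (V n)) : rpn F.oneSub = oneSubToks (rpn F) := rpn_oneSub F

/-- Tokens of a polarized formula. [folklore] -/
theorem rpn_polF (b : Bool) (F : AForm (V n)) :
    rpn (Setup.polF b F) = if b = true then oneSubToks (rpn F) else rpn F := by
  cases b
  · rfl
  · exact rpn_oneSub F

/-- Tokens of the base variable of a wire. [folklore] -/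
theorem baseToksC_eq (c : ℕ) (u : Fin n ⊕ ℕ) : baseToksC c (wireC u) = rpn (Setup.baseF c u : AForm (V n)) := by
  rcases u with i | j <;> rfl

/-- **Literal tokens**: `litToksC` on the code of a wire is `rpn` of the literal. [folklore] -/
theorem litToksC_eq (c : ℕ) (w : Fin n ⊕ ℕ) :
    litToksC (srcTableC (gcodes m C)) c (wireC w) = rpn ((setupOf m hm C hC).litF c w) := by
  cases w with
  | inl i => rfl
  | inr j =>
    have hsrc : (srcTableC (gcodes m C)).getD j (false, (1, j)) = srcRef C j := by
      rcases Nat.lt_or_ge j C.gates.length with hj | hj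
      · exact getD_srcTableC m C hj _
      · rw [getD_srcTableC_of_le m C hj, srcRef, srcLit_of_ge hj]; rfl
    show (if (1 : ℕ) = 0 then [Tok.inp j] else
      if ((srcTableC (gcodes m C)).getD j (false, (1, j))).1 = true then
        oneSubToks (baseToksC c ((srcTableC (gcodes m C)).getD j (false, (1, j))).2)
      else baseToksC c ((srcTableC (gcodes m C)).getD j (false, (1, j))).2) =
      rpn (Setup.polF (srcLit C.gates j).1 (Setup.baseF c (srcLit C.gates j).2))
    rw [if_neg one_ne_zero, hsrc, srcRef, rpn_polF, baseToksC_eq]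

/-- Selected positions: filtering `finRange` and mapping is filtering `range` and mapping. [folklore] -/
theorem map_filter_finRange {β : Type*} {k : ℕ} (p : ℕ → Bool) (G : ℕ → β) :
    ((List.finRange k).filter fun a : Fin k => p a).map (fun a : Fin k => G a) = ((List.range k).filter p).map G := by
  rw [← List.map_coe_finRange_eq_range, List.filter_map, List.map_map]
  rfl

/-- `q`-subsets of `finRange`, mapped, are `q`-subsets of `range`, mapped. [folklore] -/
theorem map_sublistsLen_finRange {β : Type*} {k : ℕ} (q : ℕ) (G : List ℕ → β) :
    ((List.finRange k).sublistsLen q).map (fun A : List (Fin k) => G (A.map Fin.val)) =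
      ((List.range k).sublistsLen q).map G := by
  rw [← List.map_coe_finRange_eq_range, sublistsLen_map, List.map_map]
  rfl

/-- The literal tokens of the arguments of a gate. [folklore] -/
theorem litToksC_getD_eq (c : ℕ) (g : Gate (Fin n)) (a : Fin g.arity) :
    litToksC (srcTableC (gcodes m C)) c ((gateC m g).2.getD a (0, 0)) = rpn ((setupOf m hm C hC).litF c (g.args a)) := by
  rw [getD_gateC_snd, litToksC_eq hm C hC]

/-- The parity-test sums on codes. [folklore] -/
theorem map_selL_eq (c j t : ℕ) (g : Gate (Fin n)) (G : AForm (V n) → AForm (V n)) (Gt : List Tok → List Tok)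
    (hG : ∀ F, rpn (G F) = Gt (rpn F)) :
    ((setupOf m hm C hC).selL c j g t).map (fun a => rpn (G ((setupOf m hm C hC).litF c (g.args a)))) =
      ((List.range g.arity).filter fun a => vvSeed (sC C) c j t a).map fun a =>
        Gt (litToksC (srcTableC (gcodes m C)) c ((gateC m g).2.getD a (0, 0))) := by
  rw [← map_filter_finRange (k := g.arity) (fun a => vvSeed (sC C) c j t a)
    (fun a => Gt (litToksC (srcTableC (gcodes m C)) c ((gateC m g).2.getD a (0, 0))))]
  refine List.map_congr_left fun a _ => ?_
  rw [hG, litToksC_getD_eq hm C hC]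

/-- **AND tokens.** [cite: BeigelTarui1994, Lemma 2.5] -/
theorem andToksC_eq (c j : ℕ) (g : Gate (Fin n)) :
    andToksC (sC C) (vvT₀ (sC C)) (srcTableC (gcodes m C)) c j (gateC m g).2 = rpn ((setupOf m hm C hC).andF' c j g) := by
  rw [Setup.andF', rpn_prodL_eq, List.map_map, andToksC, length_gateC_snd]
  congr 1
  refine List.map_congr_left fun t _ => ?_
  simp only [Function.comp_apply]
  rw [rpn_oneSub_eq, rpn_sumL_eq, List.map_map]
  congr 2
  exact (map_selL_eq hm C hC c j t g AForm.oneSub oneSubToks rpn_oneSub_eq).symm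

/-- **OR tokens.** [cite: BeigelTarui1994, Lemma 2.5] -/
theorem orToksC_eq (c j : ℕ) (g : Gate (Fin n)) :
    orToksC (sC C) (vvT₀ (sC C)) (srcTableC (gcodes m C)) c j (gateC m g).2 = rpn ((setupOf m hm C hC).orF' c j g) := by
  rw [Setup.orF', rpn_oneSub_eq, rpn_prodL_eq, List.map_map, orToksC, length_gateC_snd]
  congr 2
  refine List.map_congr_left fun t _ => ?_
  simp only [Function.comp_apply]
  rw [rpn_oneSub_eq, rpn_sumL_eq, List.map_map]
  congr 2
  exact (map_selL_eq hm C hC c j t g id id fun _ => rfl).symm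

/-- **MOD tokens.** [cite: BeigelTarui1994, Lemma 2.5] -/
theorem modToksC_eq (c j : ℕ) : modToksC m c j = rpn ((setupOf m hm C hC).modF' c j) := by
  rw [Setup.modF', rpn_oneSub_eq, rpn_prodL_eq, List.map_map, modToksC]
  rfl

/-- **Tokens of `e_q`.** [cite: BeigelTarui1994, Lemma 2.1] -/
theorem esymToksC_eq (c : ℕ) (g : Gate (Fin n)) (q : ℕ) :
    esymToksC (srcTableC (gcodes m C)) c (gateC m g).2 q = rpn ((setupOf m hm C hC).esymF' c g q) := by
  rw [Setup.esymF', rpn_sumL_eq, esymToksC, List.map_map, length_gateC_snd]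
  congr 1
  rw [← map_sublistsLen_finRange]
  refine List.map_congr_left fun A _ => ?_
  simp only [Function.comp_apply]
  rw [rpn_prodL_eq, List.map_map, List.map_map]
  congr 1
  refine List.map_congr_left fun a _ => ?_
  simp only [Function.comp_apply]
  exact litToksC_getD_eq hm C hC c g a

/-- **Auxiliary tokens.** [cite: BeigelTarui1994, Lemma 2.1] -/
theorem auxToksC_eq (c : ℕ) (g : Gate (Fin n)) (p : ℕ) :
    auxToksC m (srcTableC (gcodes m C)) c (gateC m g).2 p = rpn ((setupOf m hm C hC).auxF' c g p) := by
  rw [Setup.auxF', rpn_oneSub_eq, rpn_prodL_eq, auxToksC, List.map_map]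
  congr 3
  funext t
  simp only [Function.comp_apply]
  rw [rpn_oneSub_eq, rpn_pow_eq, esymToksC_eq hm C hC]

/-- **Tokens of the defining polynomials**: `ffToksC` on the codes of a circuit is `rpn ∘ FF'` of
its setup. [cite: BeigelTarui1994, Lemma 2.5] -/
theorem ffToksC_eq (c j q : ℕ) :
    ffToksC m (sC C) (vvT₀ (sC C)) (gcodes m C) (srcTableC (gcodes m C)) c j q =
      rpn ((setupOf m hm C hC).FF' (.inr (c, j, q))) := by
  rcases Nat.lt_or_ge j C.gates.length with hj | hj
  · have hjc : j < (gcodes m C).length := by simpa using hj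
    rcases q with _ | q
    · show _ = rpn ((setupOf m hm C hC).gateF' c j)
      rw [ffToksC, if_pos hjc, if_pos rfl, getD_gcodes m C hj, Setup.gateF',
        dif_pos (show j < (setupOf m hm C hC).C.gates.length from hj)]
      show (if accCode m (C.gates[j]).fn = 1 then _ else if accCode m (C.gates[j]).fn = 2 then _ else _) =
        rpn (if accCode m (C.gates[j]).fn = 1 then _ else if accCode m (C.gates[j]).fn = 2 then _ else _)
      split_ifs
      · exact andToksC_eq hm C hC c j _
      · exact orToksC_eq hm C hC c j _
      · exact modToksC_eq hm C hC c j
    · show _ = rpn ((setupOf m hm C hC).auxFj' c j (q + 1))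
      rw [ffToksC, if_pos hjc, if_neg (Nat.succ_ne_zero q), getD_gcodes m C hj, Setup.auxFj',
        dif_pos (show j < (setupOf m hm C hC).C.gates.length from hj)]
      exact auxToksC_eq hm C hC c _ (q + 1)
  · have hjc : ¬ j < (gcodes m C).length := by simpa using hj
    rw [ffToksC, if_neg hjc]
    rcases q with _ | q
    · show _ = rpn ((setupOf m hm C hC).gateF' c j)
      rw [Setup.gateF', dif_neg (show ¬ j < (setupOf m hm C hC).C.gates.length from not_lt.2 hj)]
      rfl
    · show _ = rpn ((setupOf m hm C hC).auxFj' c j (q + 1))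
      rw [Setup.auxFj', dif_neg (show ¬ j < (setupOf m hm C hC).C.gates.length from not_lt.2 hj)]
      rfl

/-- **Batches on codes**: the batch test of the substitution is `admC ∧ levC = ℓ`. [folklore] -/
theorem batch_iff (ℓ c j q : ℕ) :
    (setupOf m hm C hC).Batch ℓ (.inr (c, j, q)) ↔
      (admC m (gcodes m C) j q = true ∧ levC m (depthsC (gcodes m C)) j q = ℓ) := by
  rw [depthsC_map_gateC]
  have hcode : ∀ {j : ℕ}, j < C.gates.length →
      (((gcodes m C).getD j (0, [])).1 = 0 ↔ (setupOf m hm C hC).code j = 0) := fun {j} hj => by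
    rw [getD_gcodes m C hj, Setup.code_eq _ (show j < (setupOf m hm C hC).C.gates.length from hj)]
    rfl
  unfold Setup.Batch admC levC
  simp only [length_gcodes, Bool.and_eq_true, decide_eq_true_eq, Bool.not_eq_true', decide_eq_false_iff_not,
    Bool.or_eq_true]
  rcases q with _ | q
  · show (j < C.gates.length ∧ (setupOf m hm C hC).code j ≠ 0) ∧
        (m + 1) * (wdepths acWeight C.gates).getD j 0 = ℓ ↔ _
    simp only [true_or, and_true, Nat.sub_zero]
    constructor
    · rintro ⟨⟨hj, hc⟩, hl⟩; exact ⟨⟨hj, fun h => hc ((hcode hj).1 h)⟩, hl⟩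
    · rintro ⟨⟨hj, hc⟩, hl⟩; exact ⟨⟨hj, fun h => hc ((hcode hj).2 h)⟩, hl⟩
  · show (j < C.gates.length ∧ (setupOf m hm C hC).code j ≠ 0 ∧ q + 1 ∈ m.primeFactors) ∧
        (m + 1) * (wdepths acWeight C.gates).getD j 0 - (q + 1) = ℓ ↔ _
    simp only [Nat.succ_ne_zero, false_or]
    constructor
    · rintro ⟨⟨hj, hc, hp⟩, hl⟩; exact ⟨⟨⟨hj, fun h => hc ((hcode hj).1 h)⟩, hp⟩, hl⟩
    · rintro ⟨⟨⟨hj, hc⟩, hp⟩, hl⟩; exact ⟨⟨hj, fun h => hc ((hcode hj).2 h), hp⟩, hl⟩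

/-- **The stage substitution on tokens** is `rpn ∘ tau` (for a stage below the top level). [cite: BeigelTarui1994, Lemma 2.8] -/
theorem substTokC_eq {lam a e₀ Lmax k : ℕ} (hk : k < Lmax) (v : V n) :
    substTokC m (sC C) (vvT₀ (sC C)) lam a e₀ Lmax k (gcodes m C) (depthsC (gcodes m C)) (srcTableC (gcodes m C))
      (varTok v) = rpn ((setupOf m hm C hC).tau lam a e₀ Lmax k v) := by
  unfold Setup.tau AForm.collapseSubst
  rcases v with i | ⟨c, j, q⟩
  · have hB : ¬ (setupOf m hm C hC).Batch (Lmax - k) (.inl i) := fun h => by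
      have := h.2; change (0 : ℕ) = Lmax - k at this; omega
    rw [if_neg hB]; rfl
  · show substTokC m (sC C) (vvT₀ (sC C)) lam a e₀ Lmax k (gcodes m C) (depthsC (gcodes m C))
      (srcTableC (gcodes m C)) (Tok.gv c j q) = _
    rw [substTokC_gv]
    by_cases hB : (setupOf m hm C hC).Batch (Lmax - k) (.inr (c, j, q))
    · rw [if_pos hB, if_pos ((batch_iff hm C hC _ c j q).1 hB), rpn_todaIter, rpn_pow_eq, ffToksC_eq hm C hC]
      rfl
    · rw [if_neg hB, if_neg (fun h => hB ((batch_iff hm C hC _ c j q).2 h))]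
      rfl

/-- **The tokens after `k ≤ Lmax` stages are `rpn (Rk k)`.** [cite: BeigelTarui1994, Lemma 2.8] -/
theorem toksC_eq {T lam a e₀ Lmax : ℕ} : ∀ k, k ≤ Lmax →
    toksC m (sC C) (vvT₀ (sC C)) T lam a e₀ Lmax (gcodes m C) (depthsC (gcodes m C)) (srcTableC (gcodes m C))
      (wireC C.output) k = rpn ((setupOf m hm C hC).Rk T lam a e₀ Lmax k)
  | 0, _ => by
    rw [toksC, topToksC, Setup.Rk, rpn_sumL_eq, List.map_map]
    congr 2
    funext c
    exact litToksC_eq hm C hC c C.output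
  | k + 1, hk => by
    rw [toksC, toksC_eq k (Nat.le_of_succ_le hk), Setup.Rk]
    exact (rpn_subst _ _ (fun v => substTokC_eq hm C hC (Nat.lt_of_succ_le hk) v) (fun _ => rfl) rfl rfl _).symm

/-- The decoder chain of the setup is `chainC m`. [folklore] -/
theorem chain_eq_chainC (lam a e₀ Lmax : ℕ) : ∀ k,
    (setupOf m hm C hC).chain lam a e₀ Lmax k = chainC m lam a e₀ Lmax k
  | 0 => rfl
  | k + 1 => by
    rw [Setup.chain, chainC, chain_eq_chainC lam a e₀ Lmax k]
    rfl

/-- The symmetric gate of the setup is `symOfC m`. [folklore] -/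
theorem symOf_eq_symOfC (T lam a e₀ Lmax N : ℕ) :
    (setupOf m hm C hC).symOf T lam a e₀ Lmax N = symOfC m T lam a e₀ Lmax N := by
  rw [Setup.symOf, symOfC, chain_eq_chainC]

include hC in
/-- **The conversion on codes computes the code of the explicit `SYM⁺` circuit** (Williams 2014,
Lemma 4.1: the algorithm "outputs an equivalent `SYM⁺` circuit"). [cite: Williams2014, Lemma 4.1 and Appendix A] -/
theorem convCode_eq (d : ℕ) (hd : C.acDepth ≤ d) :
    convCode d m (n, wireC C.output, gcodes m C) = symPlusCodeList (accSymPlus d m hm C) := by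
  obtain ⟨-, hvars, -, -⟩ := inv_setupOf d m hm C hC hd
  rw [accSymPlus_eq d m hm C hC, symPlusCodeList_explicitSymPlus _ hvars]
  have hP : expandToks (toksC m (sC C) (vvT₀ (sC C)) (vvT (sC C))
      (Nat.log 2 (sC C) + 2) (4 * m + 10) 7 ((m + 1) * d) (gcodes m C) (depthsC (gcodes m C))
      (srcTableC (gcodes m C)) (wireC C.output) ((m + 1) * d)) =
      expandK ((setupOf m hm C hC).Rk (vvT (sC C)) (lamC C) (4 * m + 10) 7 ((m + 1) * d) ((m + 1) * d)) := by
    rw [toksC_eq hm C hC _ le_rfl, expandToks_rpn]; rfl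
  have hsym : (fun N => if symOfC m (vvT (sC C)) (Nat.log 2 (sC C) + 2) (4 * m + 10) 7 ((m + 1) * d) N then 1 else 0) =
      (fun N => if (setupOf m hm C hC).symOf (vvT (sC C)) (lamC C) (4 * m + 10) 7 ((m + 1) * d) N then 1 else 0) := by
    funext N; rw [symOf_eq_symOfC]; rfl
  simp only [convCode, szC_eq]
  rw [hP, hsym]
  rfl

end tokens

end BT

end Literature.Computability.Complexity
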